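import Literature.NumberTheory.IwasawaTheory.WeakLeopoldtCyclotomic
import Literature.NumberTheory.GaloisRepresentations.ProfiniteIntersectionTorsionCoefficients
import Literature.NumberTheory.GaloisRepresentations.ModNCyclotomicCharacter
import HarnessLib

/-!
# Weak Leopoldt for the cyclotomic tower, assembly I: the cyclotomic LEVELS and the limit step above
# `K′(μ_{p^∞})` (NSW (10.3.25), proof; Serre I §2.2 Prop. 8) — reduction to a finite-level killing statement

Topic `NumberTheory/IwasawaTheory`; namespace `Literature.NumberTheory.IwasawaTheory`.  Theorems only
(no definition, no named fact, no instance; D-0026).  Width seat `bsd-line-x1-p1-w2` (gen 7) of cell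
`bsd-eis`, D-0154 (2) INPUTS lane for the named fact
`weakLeopoldt_H2_subsingleton_cyclotomic_of_isOpen` (`WeakLeopoldtCyclotomic.lean`; ⟺ (T4) of
`Greenberg2006/GaloisCohomologyStructure.lean` by `Summits/…/EisensteinPrimesGoodLatticeBDPValueT4OfCyclotomic`).

Fix a number field `K`, a prime `p`, a finite `S ⊇ {v ∣ p}` and an open `U₀ ≤ Γ_K` with `N_S ≤ U₀`
(`K′ := K̄^{U₀} ⊆ K_Σ`).  The CYCLOTOMIC LEVELS are the open normal subgroups
`F_k := ker(χ̄_{p^k} : Γ_K → (ℤ/p^k)ˣ) = Gal(K̄/K(μ_{p^k}))` (`modNCyclotomicCharacter K (p^k)`), and the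
STAGES the closed subgroups `G_k := galoisGroupAbove S (U₀ ⊓ F_k) = Gal(K_Σ/K′(μ_{p^k})) ≤ G_{K,S}`, with
`⋂ₖ G_k = galoisGroupAbove S (U₀ ⊓ ⋂ₖ F_k) = Gal(K_Σ/K′(μ_{p^∞}))`.

* §1 the levels: `F_{k'} ≤ F_k` (`k ≤ k'`), `F_k` open, `N_S ≤ F_k` when `S ⊇ {v ∣ p}` (`χ̄_{p^k}` is
  unramified outside `p`), elements of `F_k` fix the `p^k`-th roots of unity, `⋂ₖ F_k ≤ ker κ^{cyc}`.
* §2 **`subsingleton_H2_above_muInfty_of_stagesDie`** — `H²(Gal(K_Σ/K′(μ_{p^∞})), D) = 0` for every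
  discrete torsion `D` with the trivial action (any inert coefficient ring), PROVIDED the finite-level
  killing statement («stagesDie»): every continuous `2`-cocycle of a stage `G_k` with values in a finite
  subgroup `A ≤ D` killed by `p^a`, `a ≤ k` (so that `K′(μ_{p^k}) ⊇ μ_{p^a} ⊇` an isomorphic copy of `A`),
  becomes — restricted to a deeper stage `G_{k'}` and read in `D` — the coboundary of a continuous
  `1`-cochain.  This is the limit step of the proof of NSW (10.3.25) (Serre I §2.2 Prop. 8, in the
  killing form `GaloisRepresentations.subsingleton_H2_trivial_iInf_of_forall_exists`); the arithmetic
  of (10.3.25) — the Brauer part of such a class dies on a deeper cyclotomic layer (tree: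
  `GaloisCohomology.exists_resH_layerSubgroup_mu_primePow_eq_zero`) and the `S`-ideal-class part dies
  after enlarging `μ_{p^a}` to `μ_{p^{a+e}}` (radical descent, cell seats `-w8`/`-w6`) — is exactly a
  proof of «stagesDie», kept OUT of this file.

The descent from `K′(μ_{p^∞})` to `K′K^{cyc}_∞` (index prime to `p`) and the resulting implication
«stagesDie» ⟹ `weakLeopoldt_H2_subsingleton_cyclotomic_of_isOpen` are in the sequel
`WeakLeopoldtCyclotomicAssembly.lean`.  HONEST FRAMING: a conditional assembly (profinite cohomology +
cyclotomic-character bookkeeping); no case of weak Leopoldt is proved here.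

References: [NeukirchSchmidtWingberg2008] (10.3.22), (10.3.25); [SerreGaloisCohomology1997] I §2.2
Prop. 8; [Washington1997] §13.1, Prop. 13.2; [Greenberg2006] pp. 343–344.
-/

noncomputable section

open scoped Classical
open NumberField IsDedekindDomain Field
open Literature.NumberTheory.GaloisRepresentations
open Literature.NumberTheory.EllipticCurves (ZpExtension)
open Literature.NumberTheory.IwasawaTheory.Greenberg2006
open _root_.TopRep _root_.ContRepresentation _root_.ContinuousCohomology

namespace Literature.NumberTheory.IwasawaTheory

/-! ### §1. The cyclotomic levels `F_k = ker χ̄_{p^k} = Gal(K̄/K(μ_{p^k}))` -/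

section Levels

variable {K : Type} [Field K] [CharZero K] (p : ℕ) [hp : Fact p.Prime]

/-- Elements of `F_k = ker χ̄_{p^k}` fix every `p^k`-th root of unity of `K̄`.
[cite: Washington1997, §13.1] -/
theorem smul_eq_self_of_mem_ker_modNCyclotomicCharacter {k : ℕ} {σ : absoluteGaloisGroup K}
    (hσ : σ ∈ (modNCyclotomicCharacter K (p ^ k)).ker) {t : AlgebraicClosure K}
    (ht : t ^ p ^ k = 1) : σ • t = t := by
  have h := modNCyclotomicCharacter_spec K (p ^ k) σ t ht
  rw [MonoidHom.mem_ker] at hσ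
  rw [hσ, Units.val_one] at h
  rcases Nat.lt_or_ge 1 (p ^ k) with h1 | h1
  · haveI : Fact (1 < p ^ k) := ⟨h1⟩
    rwa [ZMod.val_one, pow_one] at h
  · -- `p ^ k = 1` (i.e. `k = 0`): `t = 1`
    have hk : p ^ k = 1 := le_antisymm h1 (Nat.one_le_pow _ _ hp.out.pos)
    rw [hk, pow_one] at ht
    rw [ht, smul_one]

/-- The levels decrease: `F_{k'} ≤ F_k` for `k ≤ k'` (a `p^k`-th root of unity is a `p^{k'}`-th one).
[cite: Washington1997, §13.1] -/
theorem ker_modNCyclotomicCharacter_antitone :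
    Antitone fun k : ℕ ↦ (modNCyclotomicCharacter K (p ^ k)).ker := by
  intro k k' hkk' σ hσ
  obtain ⟨ζ, hζ⟩ := HasEnoughRootsOfUnity.exists_primitiveRoot (AlgebraicClosure K) (p ^ k)
  have hfix : σ • ζ = ζ := by
    refine smul_eq_self_of_mem_ker_modNCyclotomicCharacter p hσ ?_
    obtain ⟨m, hm⟩ := pow_dvd_pow p hkk'
    rw [hm, pow_mul, hζ.pow_eq_one, one_pow]
  rw [MonoidHom.mem_ker]
  ext
  rw [Units.val_one, ← Nat.cast_one]
  exact modNCyclotomicCharacter_eq_of_smul_eq_pow K (p ^ k) hζ σ (by rw [pow_one]; exact hfix)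

/-- `F_k` is open (the mod `p^k` cyclotomic character is locally constant). [folklore: Krull topology]
[cite: Washington1997, §13.1] -/
theorem isOpen_ker_modNCyclotomicCharacter (k : ℕ) :
    IsOpen (((modNCyclotomicCharacter K (p ^ k)).ker : Subgroup (absoluteGaloisGroup K)) :
      Set (absoluteGaloisGroup K)) := by
  exact Subgroup.isOpen_of_mem_nhds (g := 1) _
    ((modNCyclotomicCharacter_eventually_eq_one K (p ^ k)).mono fun σ hσ ↦ hσ)

/-- `⋂ₖ F_k ≤ ker κ^{cyc}`: an automorphism fixing all `p`-power roots of unity has `χ_p = 1`, a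
torsion value, so it lies in the kernel of the cyclotomic `ℤ_p`-extension (`IsCyclotomic`:
`ker κ^{cyc} = χ_p⁻¹(μ(ℤ_p))`). [cite: Washington1997, §13.1] -/
theorem iInf_ker_modNCyclotomicCharacter_le_kerSubgroup {κ : ZpExtension K p} (hκ : κ.IsCyclotomic) :
    (⨅ k : ℕ, (modNCyclotomicCharacter K (p ^ k)).ker) ≤ κ.kerSubgroup := by
  intro σ hσ
  rw [Subgroup.mem_iInf] at hσ
  have hχ : GaloisRep.cyclotomicCharacter K p σ = 1 := by
    rw [GaloisRep.cyclotomicCharacter_apply]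
    exact cyclotomicCharacter_eq_one_of_forall_pow_eq_one p _ fun n t ht ↦
      smul_eq_self_of_mem_ker_modNCyclotomicCharacter p (hσ n) ht
  have h : κ.kerSubgroup = (CommGroup.torsion ℤ_[p]ˣ).comap
      (GaloisRep.cyclotomicCharacter K p).toMonoidHom := hκ
  rw [h, Subgroup.mem_comap]
  change GaloisRep.cyclotomicCharacter K p σ ∈ CommGroup.torsion ℤ_[p]ˣ
  rw [hχ]
  exact one_mem _

variable [NumberField K]

/-- **`N_S ≤ F_k` when `S ⊇ {v ∣ p}`**: the mod `p^k` cyclotomic character is unramified outside `p`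
(inertia at `v ∤ p` fixes the `p`-power roots of unity), so it kills the ramification subgroup `N_S`.
[cite: Washington1997, Prop. 13.2 and §13.1] [cite: NeukirchSchmidtWingberg2008, VIII §3] -/
theorem ramificationSubgroup_le_ker_modNCyclotomicCharacter (S : Set (HeightOneSpectrum (𝓞 K)))
    (hS : ∀ v : HeightOneSpectrum (𝓞 K), ((p : ℕ) : 𝓞 K) ∈ v.asIdeal → v ∈ S) (k : ℕ) :
    ramificationSubgroup K S ≤ (modNCyclotomicCharacter K (p ^ k)).ker := by
  refine ramificationSubgroup_le_ker _ (isOpen_ker_modNCyclotomicCharacter p k) fun v hv 𝔓 h𝔓 σ hσ ↦ ?_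
  haveI : 𝔓.IsPrime := h𝔓.1
  have hpv : ((p : ℕ) : 𝓞 K) ∉ v.asIdeal := fun h ↦ hv (hS v h)
  refine modNCyclotomicCharacter_eq_one_of_mem_inertia (𝔓 := 𝔓) ?_ hσ
  -- `p^k ∉ 𝔓`: otherwise `p ∈ 𝔓 ∩ 𝓞_K = v`
  intro hmem
  have hp𝔓 : ((p : ℕ) : absIntegers (𝓞 K) K) ∈ 𝔓 := by
    rw [Nat.cast_pow] at hmem
    exact Ideal.IsPrime.mem_of_pow_mem inferInstance k hmem
  haveI : 𝔓.LiesOver v.asIdeal := h𝔓.2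
  apply hpv
  rw [Ideal.mem_of_liesOver (P := 𝔓) (p := v.asIdeal), map_natCast]
  exact hp𝔓

end Levels

/-! ### §2. `H²(Gal(K_Σ/K′(μ_{p^∞})), D) = 0` from the finite-level killing statement -/

section Assembly

variable {K : Type} [Field K] [NumberField K] (p : ℕ) [hp : Fact p.Prime]
  (S : Set (HeightOneSpectrum (𝓞 K)))

/-- Transport of `H²(H, D) = 0` (trivial coefficients) along an equality of subgroups. [folklore] -/
private theorem subsingleton_H2_congr {G : Type} [Group G] [TopologicalSpace G] [IsTopologicalGroup G]
    {R : Type} [CommRing R] [TopologicalSpace R]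
    {D : Type} [AddCommGroup D] [Module R D] [TopologicalSpace D] [DiscreteTopology D]
    [ContinuousSMul R D] {H₁ H₂ : Subgroup G} (e : H₁ = H₂)
    (h : Subsingleton (continuousCohomology 2 (ContinuousRep.trivial H₁ R D).toTopRep)) :
    Subsingleton (continuousCohomology 2 (ContinuousRep.trivial H₂ R D).toTopRep) := by
  subst e
  exact h

omit hp in
/-- A finite subgroup of a `p`-primary torsion group is killed by a single power of `p`. [folklore] -/
private theorem exists_pow_nsmul_eq_zero_of_finite {D : Type} [AddCommGroup D]
    (hptors : ∀ x : D, ∃ n : ℕ, p ^ n • x = 0) (A : AddSubgroup D) [Finite A] :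
    ∃ a : ℕ, ∀ x ∈ A, p ^ a • x = 0 := by
  classical
  haveI := Fintype.ofFinite A
  let f : A → ℕ := fun x ↦ Nat.find (hptors (x : D))
  refine ⟨Finset.univ.sup f, fun x hx ↦ ?_⟩
  have hfx : p ^ f ⟨x, hx⟩ • x = 0 := Nat.find_spec (hptors x)
  have hle : f ⟨x, hx⟩ ≤ Finset.univ.sup f := Finset.le_sup (Finset.mem_univ _)
  obtain ⟨d, hd⟩ := Nat.exists_eq_add_of_le hle
  rw [hd, pow_add, mul_nsmul, hfx, nsmul_zero]

/-- **The stages `G_k = Gal(K_Σ/K′(μ_{p^k}))` decrease.** [cite: Washington1997, §13.1] -/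
theorem galoisGroupAbove_inf_ker_modNCyclotomicCharacter_antitone (U₀ : Subgroup (absoluteGaloisGroup K)) :
    Antitone fun k : ℕ ↦
      galoisGroupAbove S (U₀ ⊓ (modNCyclotomicCharacter K (p ^ k)).ker) :=
  fun _ _ h ↦ Subgroup.map_mono (inf_le_inf_left U₀ (ker_modNCyclotomicCharacter_antitone p h))

/-- **`H²(Gal(K_Σ/K′(μ_{p^∞})), D) = 0` FROM THE FINITE-LEVEL KILLING STATEMENT** (the limit step of
the proof of NSW (10.3.25), Serre I §2.2 Prop. 8 in killing form).  Data: a number field `K`, a prime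
`p`, `S ⊇ {v ∣ p}`, an open `U₀ ≥ N_S` (`K′ = K̄^{U₀} ⊆ K_Σ`); a discrete `p`-primary torsion abelian
group `D` with the trivial action over any inert coefficient ring `R`.  HYPOTHESIS «stagesDie»: for
all `a ≤ k`, every finite subgroup `A ≤ D` killed by `p^a` and every continuous `2`-cocycle `c` of the
stage `G_k = galoisGroupAbove S (U₀ ⊓ ker χ̄_{p^k}) = Gal(K_Σ/K′(μ_{p^k}))` with values in `A` (trivial
action, over `ℤ`), there are `k' ≥ k` and a continuous `1`-cochain `b : G_{k'} → D` with
`c(σ, τ) = b(τ) − b(στ) + b(σ)` in `D` on `G_{k'}`.  CONCLUSION: the continuous `H²` of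
`galoisGroupAbove S (U₀ ⊓ ⋂ₖ ker χ̄_{p^k}) = Gal(K_Σ/K′(μ_{p^∞}))` with coefficients `D` vanishes.
[cite: NeukirchSchmidtWingberg2008, (10.3.25) (proof), (10.3.22)] [cite: SerreGaloisCohomology1997, I §2.2 Prop. 8] -/
theorem subsingleton_H2_above_muInfty_of_stagesDie
    (hS : ∀ v : HeightOneSpectrum (𝓞 K), ((p : ℕ) : 𝓞 K) ∈ v.asIdeal → v ∈ S)
    (U₀ : Subgroup (absoluteGaloisGroup K)) (hU₀ : IsOpen (U₀ : Set (absoluteGaloisGroup K)))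
    (hN : ramificationSubgroup K S ≤ U₀)
    {R : Type} [CommRing R] [TopologicalSpace R]
    {D : Type} [AddCommGroup D] [Module R D] [TopologicalSpace D] [DiscreteTopology D]
    [ContinuousSMul R D] (hptors : ∀ x : D, ∃ n : ℕ, p ^ n • x = 0)
    (hdie : ∀ (k a : ℕ), a ≤ k → ∀ (A : AddSubgroup D) [Finite A], (∀ x ∈ A, p ^ a • x = 0) →
      ∀ c : contTwoCocycles (((ContinuousRep.trivial (GaloisGroupUnramifiedOutside K S) ℤ A).restrict
          (subgroupIncl (galoisGroupAbove S (U₀ ⊓ (modNCyclotomicCharacter K (p ^ k)).ker)))).toTopRep),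
      ∃ (k' : ℕ) (hkk' : k ≤ k')
        (b : C(galoisGroupAbove S (U₀ ⊓ (modNCyclotomicCharacter K (p ^ k')).ker), D)),
        ∀ σ τ : galoisGroupAbove S (U₀ ⊓ (modNCyclotomicCharacter K (p ^ k')).ker),
          ((c.1 (Subgroup.inclusion
              (galoisGroupAbove_inf_ker_modNCyclotomicCharacter_antitone p S U₀ hkk') σ,
            Subgroup.inclusion
              (galoisGroupAbove_inf_ker_modNCyclotomicCharacter_antitone p S U₀ hkk') τ) : A) : D) =
            b τ - b (σ * τ) + b σ) :
    Subsingleton (continuousCohomology 2 (ContinuousRep.trivial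
      (galoisGroupAbove S (U₀ ⊓ ⨅ k : ℕ, (modNCyclotomicCharacter K (p ^ k)).ker)) R D).toTopRep) := by
  classical
  -- the profinite group `G_{K,S}` and the stages
  haveI : TotallyDisconnectedSpace (GaloisGroupUnramifiedOutside K S) :=
    totallyDisconnectedSpace_galoisGroupUnramifiedOutside S
  set St : ℕ → Subgroup (GaloisGroupUnramifiedOutside K S) :=
    fun k ↦ galoisGroupAbove S (U₀ ⊓ (modNCyclotomicCharacter K (p ^ k)).ker) with hSt
  have hanti : Antitone St := galoisGroupAbove_inf_ker_modNCyclotomicCharacter_antitone p S U₀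
  have hcl : ∀ k, IsClosed ((St k : Subgroup (GaloisGroupUnramifiedOutside K S)) :
      Set (GaloisGroupUnramifiedOutside K S)) := fun k ↦
    isClosed_galoisGroupAbove S _ ((Subgroup.isClosed_of_isOpen U₀ hU₀).inter
      (Subgroup.isClosed_of_isOpen _ (isOpen_ker_modNCyclotomicCharacter p k)))
  have htors : AddMonoid.IsTorsion D := fun x ↦ by
    obtain ⟨n, hn⟩ := hptors x
    exact isOfFinAddOrder_iff_nsmul_eq_zero.mpr ⟨p ^ n, pow_pos hp.out.pos n, hn⟩
  -- the killing form of Serre I §2.2 Prop. 8 on the tower `St`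
  have hlim : Subsingleton (continuousCohomology 2
      (ContinuousRep.trivial (⨅ k, St k : Subgroup (GaloisGroupUnramifiedOutside K S)) R D).toTopRep) := by
    refine subsingleton_H2_trivial_iInf_of_forall_exists' htors St hanti hcl fun k A _ c ↦ ?_
    -- kill the coefficients by `p^a`, move to the stage `k₁ = max k a`, apply «stagesDie»
    obtain ⟨a, ha⟩ := exists_pow_nsmul_eq_zero_of_finite p hptors A
    set k₁ := max k a with hk₁
    have hk : k ≤ k₁ := le_max_left k a
    let c₁ : contTwoCocycles (((ContinuousRep.trivial (GaloisGroupUnramifiedOutside K S) ℤ A).restrict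
        (subgroupIncl (St k₁))).toTopRep) :=
      ⟨⟨fun q ↦ c.1 (Subgroup.inclusion (hanti hk) q.1, Subgroup.inclusion (hanti hk) q.2),
        c.1.continuous.comp ((continuous_inclusion (hanti hk)).prodMap (continuous_inclusion (hanti hk)))⟩,
        fun σ τ υ ↦ by
          have h := c.2 (Subgroup.inclusion (hanti hk) σ) (Subgroup.inclusion (hanti hk) τ)
            (Subgroup.inclusion (hanti hk) υ)
          rw [ContinuousRep.toTopRep_ρ_apply, ContinuousRep.restrict_apply, subgroupIncl_apply,
            ContinuousRep.trivial_apply] at h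
          rw [ContinuousRep.toTopRep_ρ_apply, ContinuousRep.restrict_apply, subgroupIncl_apply,
            ContinuousRep.trivial_apply]
          simp only [ContinuousMap.coe_mk, map_mul]
          exact h⟩
    obtain ⟨k', hk₁k', b, hb⟩ := hdie k₁ a (le_max_right k a) A ha c₁
    refine ⟨k', hk.trans hk₁k', b, fun σ τ ↦ ?_⟩
    have h := hb σ τ
    exact h
  -- `Gal(K_Σ/K′(μ_{p^∞})) = ⋂ₖ G_k` inside `G_{K,S}`
  have hNF : ∀ k, ramificationSubgroup K S ≤ U₀ ⊓ (modNCyclotomicCharacter K (p ^ k)).ker := fun k ↦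
    le_inf hN (ramificationSubgroup_le_ker_modNCyclotomicCharacter p S hS k)
  have heq : (⨅ k, St k) =
      galoisGroupAbove S (U₀ ⊓ ⨅ k : ℕ, (modNCyclotomicCharacter K (p ^ k)).ker) := by
    refine le_antisymm (fun g hg ↦ ?_) (le_iInf fun k ↦ Subgroup.map_mono
      (inf_le_inf_left U₀ (iInf_le _ k)))
    rw [Subgroup.mem_iInf] at hg
    obtain ⟨σ, rfl⟩ := toUnramifiedQuot_surjective K S g
    refine (mem_galoisGroupAbove_iff S _ _).mpr ⟨σ, ?_, rfl⟩
    have hmem : ∀ k, σ ∈ U₀ ⊓ (modNCyclotomicCharacter K (p ^ k)).ker := fun k ↦ by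
      obtain ⟨τ, hτ, hτσ⟩ := (mem_galoisGroupAbove_iff S _ _).mp (hg k)
      have h1 : toUnramifiedQuot K S (τ⁻¹ * σ) = 1 := by
        rw [map_mul, map_inv, hτσ, inv_mul_cancel]
      have h2 : τ⁻¹ * σ ∈ ramificationSubgroup K S := (QuotientGroup.eq_one_iff _).mp h1
      simpa using (U₀ ⊓ (modNCyclotomicCharacter K (p ^ k)).ker).mul_mem hτ (hNF k h2)
    refine Subgroup.mem_inf.mpr ⟨(Subgroup.mem_inf.mp (hmem 0)).1, ?_⟩
    rw [Subgroup.mem_iInf]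
    exact fun k ↦ (Subgroup.mem_inf.mp (hmem k)).2
  exact subsingleton_H2_congr heq hlim

end Assembly

end Literature.NumberTheory.IwasawaTheory

end
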